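import Mathlib
import Summits.MatrixMultiplication.MatrixMultiplication.Theses.FourierTwoFamiliesModP
import Summits.MatrixMultiplication.MatrixMultiplication.Theorems.FourierTwoFamiliesModPCyclicReductionTransfer
import Literature.Computability.AlgebraicComplexity.PrattTrapezoidValDecomp
import Literature.Computability.AlgebraicComplexity.PrattTrapezoidValSliceRank

/-!
# `CyclicReduction`: the two-families conjecture loses nothing in prime cyclic hosts

Item `stmt-MatrixMultiplication-14313` of route `FourierTwoFamiliesModP`: CKSU Conj. 4.7 over all finite
abelian groups (verbatim the hypothesis of the tree's `pratt2024_thm47_aux`) `↔ PrimeTwoFamilies`.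

* (←) `H := ℤ/pℤ`.
* (→) `primeTwoFamilies_of_abelian_aux`: Umans' cyclic reduction (Pratt, arXiv:2309.03878, p. 10, the
  mechanism of the proof of Thm. 4.7) made effective.  Given `δ ∈ (0,1]`, invoke the abelian conjecture
  with `δ' = δ/(M+4)`; decompose `H ≃ ∏_{j<k} ℤ/m_j` (`exists_pi_zmod_decomp`, threshold `L` with
  `log L ≥ 12 log 3/δ`), `k = k_L + Σ_{q ≤ L} r_q`, `L^{k_L} ≤ |H|`; the CKSU STPP family in `H³` on a
  Behrend corner-free index set over a balanced sub-family of the pairs, fed to the slice-rank bound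
  (`sum_card_div_le_of_addEquiv_piZMod`) on each homocyclic component `(ℤ/q)^{r_q}`, gives
  `3Λ r_q ≤ 9 δ' log n + c₀` — this is the counting of `pratt2024_thm47_aux` verbatim; hence
  `k log 3 ≤ (δ/4) log n + (M/4) δ' log n + O(1)`.  The transfer file
  (`exists_prime_sdpp_of_addEquiv`) then moves the pairs into `ℤ/pℤ` with `p ≤ 2 · 3^k |H| ≤ n^{2+δ}`.
* `cyclicReduction_proof : CyclicReduction` (general `δ > 0` reduced to `min δ 1`).
-/

-- single-conjunct summit: the mandated namespace `Summit.MatrixMultiplication.MatrixMultiplication.…`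
-- repeats `MatrixMultiplication` (summit = sub-problem), which `linter.dupNamespace` would flag.
set_option linter.dupNamespace false

namespace Summit.MatrixMultiplication.MatrixMultiplication.Theorems

open Finset Literature.Computability.AlgebraicComplexity Literature.Combinatorics.Additive

/-- **Umans' cyclic reduction made effective** (Pratt, arXiv:2309.03878, p. 10): the two-families
conjecture over all finite abelian groups implies it with PRIME CYCLIC hosts, for `0 < δ ≤ 1`.
The count of cyclic factors is the one in the proof of Pratt's Thm. 4.7 (slice-rank bound of
BCCGNSU 2017 on each small homocyclic component); the transfer is the carry-free mixed-radix map
followed by a Bertrand prime. -/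
theorem primeTwoFamilies_of_abelian_aux
    (hTF : ∀ δ : ℝ, 0 < δ → ∀ n₀ : ℕ, ∃ n ≥ n₀, ∃ (H : Type) (_ : AddCommGroup H) (_ : Fintype H)
      (A B : Fin n → Finset H),
      (∀ i : Fin n, ∀ a ∈ A i, ∀ a' ∈ A i, ∀ b ∈ B i, ∀ b' ∈ B i,
          (a - a') + (b - b') = 0 → a = a' ∧ b = b') ∧
      (∀ i j k : Fin n, ∀ a ∈ A i, ∀ a' ∈ A j, ∀ b ∈ B j, ∀ b' ∈ B k,
          (a - a') + (b - b') = 0 → i = k) ∧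
      (Fintype.card H : ℝ) ≤ (n : ℝ) ^ (2 + δ) ∧
      ∀ i : Fin n, (n : ℝ) ^ (2 - δ) ≤ (((A i).card * (B i).card : ℕ) : ℝ))
    (δ : ℝ) (hδ : 0 < δ) (hδ1 : δ ≤ 1) (n₀ : ℕ) :
    ∃ n ≥ n₀, ∃ p : ℕ, p.Prime ∧ ∃ A B : Fin n → Finset (ZMod p),
      (∀ i : Fin n, ∀ a ∈ A i, ∀ a' ∈ A i, ∀ b ∈ B i, ∀ b' ∈ B i,
          (a - a') + (b - b') = 0 → a = a' ∧ b = b') ∧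
      (∀ i j k : Fin n, ∀ a ∈ A i, ∀ a' ∈ A j, ∀ b ∈ B j, ∀ b' ∈ B k,
          (a - a') + (b - b') = 0 → i = k) ∧
      (p : ℝ) ≤ (n : ℝ) ^ (2 + δ) ∧
      ∀ i : Fin n, (n : ℝ) ^ (2 - δ) ≤ (((A i).card * (B i).card : ℕ) : ℝ) := by
  classical
  /- ### constants -/
  set c3 : ℝ := Real.log 3 with hc3
  have hc3pos : 0 < c3 := Real.log_pos (by norm_num)
  set L : ℕ := ⌈Real.exp (12 * c3 / δ)⌉₊ + 2 with hL
  have hL2 : 2 ≤ L := by omega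
  have hLpos : (0 : ℝ) < L := by exact_mod_cast (show 0 < L by omega)
  have hlogL : 12 * c3 / δ ≤ Real.log L := by
    have h1 : Real.exp (12 * c3 / δ) ≤ L := by
      have h2 := Nat.le_ceil (Real.exp (12 * c3 / δ))
      have h3 : (⌈Real.exp (12 * c3 / δ)⌉₊ : ℝ) ≤ L := by rw [hL]; push_cast; linarith
      linarith
    have h4 := Real.log_le_log (Real.exp_pos _) h1
    rwa [Real.log_exp] at h4
  have hlogLpos : 0 < Real.log L := lt_of_lt_of_le (by positivity) hlogL
  choose θ hθpos hθ using Literature.Combinatorics.Additive.exists_theta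
  have hne : (Icc 2 L).Nonempty := ⟨2, mem_Icc.2 ⟨le_rfl, hL2⟩⟩
  set Λ : ℝ := (Icc 2 L).inf' hne fun q => -Real.log (θ q) with hΛ
  have hΛpos : 0 < Λ := by
    rw [hΛ, Finset.lt_inf'_iff]
    intro q hq
    have hq2 : 2 ≤ q := (mem_Icc.1 hq).1
    have := Real.log_neg (hθpos q) ((hθ q hq2).1)
    linarith
  have hΛle : ∀ q ∈ Icc 2 L, Λ ≤ -Real.log (θ q) := fun q hq =>
    Finset.inf'_le (fun q => -Real.log (θ q)) hq
  set c₀ : ℝ := Real.log 3 + 2 * Real.log 4 + 2 * Real.log 2 + Real.log 64 with hc₀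
  have hlog2 : 0 ≤ Real.log 2 := Real.log_nonneg (by norm_num)
  have hlog4 : 0 ≤ Real.log 4 := Real.log_nonneg (by norm_num)
  have hlog64 : 0 ≤ Real.log 64 := Real.log_nonneg (by norm_num)
  have hc₀nn : 0 ≤ c₀ := by rw [hc₀]; linarith
  set M : ℝ := 12 * L * c3 / Λ with hM
  have hMnn : 0 ≤ M := by positivity
  set δ' : ℝ := δ / (M + 4) with hδ'
  have hδ'pos : 0 < δ' := by positivity
  have hδ'M : δ' * (M + 4) = δ := by rw [hδ']; field_simp
  have hδ'le : δ' ≤ δ / 4 := by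
    rw [hδ']
    exact div_le_div_of_nonneg_left hδ.le (by norm_num) (by linarith)
  have hδ'δ : δ' ≤ δ := by linarith
  have hδ'1 : δ' ≤ 1 := by linarith
  set C : ℝ := L * c3 * c₀ / (3 * Λ) + Real.log 2 with hC
  have hCnn : 0 ≤ C := by positivity
  obtain ⟨n₁, hn₁⟩ := exists_cornerFree_indexMaps_card_ge δ' hδ'pos hδ'1
  set n₂ : ℕ := ⌈Real.exp (2 * C / δ)⌉₊ with hn₂
  /- ### the SDPP configuration -/
  obtain ⟨n, hn, H, _i1, _i2, A, B, hD, hSD, hcardH, hAB⟩ := hTF δ' hδ'pos (2 * n₁ + n₀ + n₂ + 16)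
  have hnpos : (0 : ℝ) < n := by exact_mod_cast (show 0 < n by omega)
  have hn1 : (1 : ℝ) < n := by exact_mod_cast (show 1 < n by omega)
  set ℓn := Real.log n with hℓn
  have hℓnpos : 0 < ℓn := Real.log_pos hn1
  have hCn : 2 * C ≤ δ * ℓn := by
    have h1 : Real.exp (2 * C / δ) ≤ n := by
      have h2 := Nat.le_ceil (Real.exp (2 * C / δ))
      have h3 : (⌈Real.exp (2 * C / δ)⌉₊ : ℝ) ≤ n := by exact_mod_cast (show n₂ ≤ n by omega)
      linarith
    have h4 := Real.log_le_log (Real.exp_pos _) h1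
    rw [Real.log_exp, div_le_iff₀ hδ] at h4
    linarith
  -- `Y = n^{2-δ'}`
  set Y : ℝ := (n : ℝ) ^ (2 - δ') with hY
  have hYpos : 0 < Y := Real.rpow_pos_of_pos hnpos _
  have hlogY : Real.log Y = 2 * ℓn - δ' * ℓn := by rw [hY, Real.log_rpow hnpos]; ring
  have hAB' : ∀ i, Y ≤ ((#(A i) * #(B i) : ℕ) : ℝ) := hAB
  have hABpos : ∀ i, 0 < #(A i) * #(B i) := fun i => by
    have h := hYpos.trans_le (hAB' i)
    exact_mod_cast h
  have hAne : ∀ i, (A i).Nonempty := fun i => card_pos.1 (Nat.pos_of_mul_pos_right (hABpos i))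
  have hBne : ∀ i, (B i).Nonempty := fun i => card_pos.1 (Nat.pos_of_mul_pos_left (hABpos i))
  -- `|H|`
  have hHpos : (0 : ℝ) < Fintype.card H := by exact_mod_cast Fintype.card_pos
  set logH := Real.log (Fintype.card H) with hlogH
  have hlogH_le : logH ≤ 2 * ℓn + δ' * ℓn := by
    have h := Real.log_le_log hHpos hcardH
    rw [Real.log_rpow hnpos] at h
    linarith
  have hδℓ : δ' * ℓn ≤ ℓn := mul_le_of_le_one_left hℓnpos.le hδ'1
  /- ### balanced sub-family -/
  obtain ⟨good, hgood2, hgood⟩ := exists_balanced_indices (S := Fintype.card H)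
    (fun i => #(A i)) (fun i => #(B i)) (sum_card_le_card_of_sdpp_left hSD hBne)
    (sum_card_le_card_of_sdpp_right hSD hAne)
  set n' := #good with hn'
  set g : Fin n' ↪o Fin n := good.orderEmbOfFin rfl with hg
  have hgmem : ∀ y, g y ∈ good := fun y => Finset.orderEmbOfFin_mem good rfl y
  have hn'ge : n₁ ≤ n' := by omega
  have hn'pos : (0 : ℝ) < n' := by exact_mod_cast (show 0 < n' by omega)
  /- ### corner-free indices and the STPP family in `H³` -/
  obtain ⟨ι₀, _, _, j₁, j₂, j₃, hι₀, hcf⟩ := hn₁ n' hn'ge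
  set i₁ : ι₀ → Fin n := fun x => g (j₁ x) with hi₁
  set i₂ : ι₀ → Fin n := fun x => g (j₂ x) with hi₂
  set i₃ : ι₀ → Fin n := fun x => g (j₃ x) with hi₃
  have hcf' : ∀ x y z : ι₀, i₁ x = i₁ z → i₂ y = i₂ x → i₃ z = i₃ y → x = y ∧ y = z :=
    fun x y z h1 h2 h3 => hcf x y z (g.injective h1) (g.injective h2) (g.injective h3)
  have hS := addSimultaneousTPP_of_sdpp hD hSD i₁ i₂ i₃ hcf'
  have hι₀pos : 0 < Fintype.card ι₀ := by
    by_contra h0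
    push Not at h0
    have h0' : Fintype.card ι₀ = 0 := by omega
    rw [h0', Nat.cast_zero, mul_zero] at hι₀
    exact absurd hι₀ (not_le.2 (Real.rpow_pos_of_pos hn'pos _))
  have hι₀posR : (0 : ℝ) < Fintype.card ι₀ := by exact_mod_cast hι₀pos
  set logι := Real.log (Fintype.card ι₀) with hlogιdef
  have hlogι : 2 * ℓn - δ' * ℓn - 2 * Real.log 2 + δ' * Real.log 2 - Real.log 64 ≤ logι := by
    have h1 := Real.log_le_log (Real.rpow_pos_of_pos hn'pos _) hι₀
    rw [Real.log_rpow hn'pos, Real.log_mul (by norm_num) hι₀posR.ne'] at h1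
    have h2 : ℓn - Real.log 2 ≤ Real.log n' := by
      rw [hℓn, ← Real.log_div hnpos.ne' two_ne_zero]
      refine Real.log_le_log (by positivity) ?_
      rw [div_le_iff₀ two_pos]
      exact_mod_cast (show n ≤ n' * 2 by omega)
    have h3 : (2 - δ') * (ℓn - Real.log 2) ≤ (2 - δ') * Real.log n' :=
      mul_le_mul_of_nonneg_left h2 (by linarith)
    linarith
  /- ### the cyclic decomposition -/
  obtain ⟨k, m, hm2, ⟨e⟩, hprod, kL, r, hk, hLk, hhomo⟩ := exists_pi_zmod_decomp H L
  /- ### the slice-rank bound on each homocyclic component: `3 Λ r_q ≤ 9 δ' log n + c₀` -/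
  set Z : ℝ := 4 * Fintype.card H / n with hZdef
  have hZpos : 0 < Z := by positivity
  have hlogZ : Real.log Z = Real.log 4 + logH - ℓn := by
    rw [hZdef, Real.log_div (by positivity) hnpos.ne', Real.log_mul (by norm_num) hHpos.ne']
  have hZ : ∀ x, (#(A (i₁ x)) : ℝ) ≤ Z ∧ (#(B (i₁ x)) : ℝ) ≤ Z ∧ (#(A (i₂ x)) : ℝ) ≤ Z ∧
      (#(B (i₂ x)) : ℝ) ≤ Z ∧ (#(A (i₃ x)) : ℝ) ≤ Z ∧ (#(B (i₃ x)) : ℝ) ≤ Z := by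
    have key : ∀ i ∈ good, (#(A i) : ℝ) ≤ Z ∧ (#(B i) : ℝ) ≤ Z := by
      intro i hi
      obtain ⟨ha, hb⟩ := hgood i hi
      rw [hZdef, le_div_iff₀ hnpos, le_div_iff₀ hnpos]
      exact ⟨by exact_mod_cast ha, by exact_mod_cast hb⟩
    intro x
    exact ⟨(key _ (hgmem _)).1, (key _ (hgmem _)).2, (key _ (hgmem _)).1, (key _ (hgmem _)).2,
      (key _ (hgmem _)).1, (key _ (hgmem _)).2⟩
  have hSdiv := card_mul_pow_div_le_sum_div_sdpp i₁ i₂ i₃ hYpos hAB' hZ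
  push_cast at hSdiv
  have hlhs_pos : 0 < (Fintype.card ι₀ : ℝ) * Y ^ 3 / (3 * Z ^ 2) :=
    div_pos (mul_pos hι₀posR (pow_pos hYpos 3)) (by positivity)
  have hloglhs : Real.log ((Fintype.card ι₀ : ℝ) * Y ^ 3 / (3 * Z ^ 2)) =
      logι + 3 * (2 * ℓn - δ' * ℓn) - (Real.log 3 + 2 * (Real.log 4 + logH - ℓn)) := by
    rw [Real.log_div (mul_pos hι₀posR (pow_pos hYpos 3)).ne' (by positivity),
      Real.log_mul hι₀posR.ne' (pow_pos hYpos 3).ne', Real.log_pow, hlogY,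
      Real.log_mul (by norm_num) (pow_pos hZpos 2).ne', Real.log_pow, hlogZ]
    push_cast
    ring
  have hr : ∀ q ∈ Icc 2 L, 3 * Λ * r q ≤ 9 * (δ' * ℓn) + c₀ := by
    intro q hq
    rcases Nat.eq_zero_or_pos (r q) with h0 | hrpos
    · rw [h0, Nat.cast_zero, mul_zero]
      positivity
    obtain ⟨p, hp, s, hqps, κ, _, _, G', _, _, _, hκ, ⟨e'⟩⟩ := hhomo q hq hrpos.ne'
    haveI : Fact p.Prime := ⟨hp⟩
    have hq2 : 2 ≤ q := (mem_Icc.1 hq).1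
    haveI : NeZero q := ⟨by omega⟩
    obtain ⟨e3⟩ := nonempty_addEquiv_triple e'
    have hb := sum_card_div_le_of_addEquiv_piZMod hS (p := p) s hqps e3 (hθpos q) (hθ q hq2).2
    have hmain := hSdiv.trans hb
    rw [Fintype.card_sum, Fintype.card_sum, hκ, Fintype.card_prod, Fintype.card_prod] at hmain
    have hθq1 : θ q < 1 := (hθ q hq2).1
    have hrhs : Real.log (θ q ^ (r q + (r q + r q)) *
        ((Fintype.card H * (Fintype.card H * Fintype.card H) : ℕ) : ℝ)) =
        3 * r q * Real.log (θ q) + 3 * logH := by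
      have hH3 : ((Fintype.card H * (Fintype.card H * Fintype.card H) : ℕ) : ℝ) ≠ 0 := by
        exact_mod_cast (Nat.mul_pos Fintype.card_pos
          (Nat.mul_pos Fintype.card_pos Fintype.card_pos)).ne'
      rw [Real.log_mul (pow_pos (hθpos q) _).ne' hH3, Real.log_pow]
      push_cast
      rw [Real.log_mul hHpos.ne' (mul_pos hHpos hHpos).ne', Real.log_mul hHpos.ne' hHpos.ne']
      ring
    have h1 := Real.log_le_log hlhs_pos hmain
    rw [hloglhs, hrhs] at h1
    have h2 : (r q : ℝ) * Λ ≤ (r q) * (-Real.log (θ q)) :=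
      mul_le_mul_of_nonneg_left (hΛle q hq) (Nat.cast_nonneg _)
    rw [hc₀]
    linarith [h1, h2, hlogH_le, hlogι, hδℓ, hlog2, mul_nonneg hδ'pos.le hlog2]
  /- ### counting the cyclic factors -/
  have hsumr : 3 * Λ * ((∑ q ∈ Icc 2 L, r q : ℕ) : ℝ) ≤ L * (9 * (δ' * ℓn) + c₀) := by
    push_cast
    rw [Finset.mul_sum]
    calc ∑ q ∈ Icc 2 L, 3 * Λ * (r q : ℝ) ≤ ∑ _q ∈ Icc 2 L, (9 * (δ' * ℓn) + c₀) :=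
          sum_le_sum hr
      _ = (#(Icc 2 L) : ℝ) * (9 * (δ' * ℓn) + c₀) := by rw [sum_const, nsmul_eq_mul]
      _ ≤ L * (9 * (δ' * ℓn) + c₀) := by
          refine mul_le_mul_of_nonneg_right ?_ (by positivity)
          have : #(Icc 2 L) ≤ L := by rw [Nat.card_Icc]; omega
          exact_mod_cast this
  have hkL : (kL : ℝ) * Real.log L ≤ logH := by
    have h1 : ((L ^ kL : ℕ) : ℝ) ≤ Fintype.card H := by exact_mod_cast hLk
    have h2 := Real.log_le_log (by exact_mod_cast pow_pos (show 0 < L by omega) kL) h1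
    rwa [Nat.cast_pow, Real.log_pow] at h2
  have hkR : (k : ℝ) = kL + ((∑ q ∈ Icc 2 L, r q : ℕ) : ℝ) := by exact_mod_cast hk
  -- `c3 kL ≤ (1/4) δ log n`
  have hkL' : 3 * c3 * kL ≤ 3 / 4 * (δ * ℓn) := by
    have h12 : 12 * c3 ≤ δ * Real.log L := by
      have := (div_le_iff₀ hδ).1 hlogL
      linarith
    have hkL0 : (0 : ℝ) ≤ kL := Nat.cast_nonneg _
    have h1 : 12 * c3 * kL ≤ δ * Real.log L * kL := mul_le_mul_of_nonneg_right h12 hkL0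
    have h2 : δ * Real.log L * kL ≤ δ * (3 * ℓn) := by
      rw [mul_assoc]
      refine mul_le_mul_of_nonneg_left ?_ hδ.le
      calc Real.log L * kL = kL * Real.log L := mul_comm _ _
        _ ≤ logH := hkL
        _ ≤ 2 * ℓn + δ' * ℓn := hlogH_le
        _ ≤ 3 * ℓn := by linarith
    linarith
  -- `3 c3 Σ r ≤ (3/4) M δ' log n + L c3 c₀ / Λ`
  have hsumr' : 3 * c3 * ((∑ q ∈ Icc 2 L, r q : ℕ) : ℝ) ≤
      3 / 4 * (M * (δ' * ℓn)) + L * c3 * c₀ / Λ := by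
    have h1 := mul_le_mul_of_nonneg_left hsumr (div_nonneg hc3pos.le hΛpos.le)
    have e1 : c3 / Λ * (3 * Λ * ((∑ q ∈ Icc 2 L, r q : ℕ) : ℝ)) =
        3 * c3 * ((∑ q ∈ Icc 2 L, r q : ℕ) : ℝ) := by field_simp
    have e2 : c3 / Λ * (L * (9 * (δ' * ℓn) + c₀)) = 3 / 4 * (M * (δ' * ℓn)) + L * c3 * c₀ / Λ := by
      rw [hM]; field_simp; ring
    rwa [e1, e2] at h1
  have hMδ : M * (δ' * ℓn) = δ * ℓn - 4 * (δ' * ℓn) := by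
    have : M * δ' = δ - 4 * δ' := by linarith [hδ'M]
    calc M * (δ' * ℓn) = (M * δ') * ℓn := by ring
      _ = (δ - 4 * δ') * ℓn := by rw [this]
      _ = δ * ℓn - 4 * (δ' * ℓn) := by ring
  have hCdef : L * c3 * c₀ / Λ = 3 * (C - Real.log 2) := by
    rw [hC]; ring
  -- `k log 3 + log |H| + log 2 ≤ (2 + δ) log n`
  have hkc3 : (k : ℝ) * c3 = kL * c3 + ((∑ q ∈ Icc 2 L, r q : ℕ) : ℝ) * c3 := by rw [hkR]; ring
  have hexp : Real.log 2 + k * c3 + logH ≤ (2 + δ) * ℓn := by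
    linarith [hkc3, hkL', hsumr', hMδ, hCdef, hCn, hlogH_le, hδℓ]
  /- ### the prime cyclic host -/
  have hm0 : ∀ j, 0 < m j := fun j => by have := hm2 j; omega
  obtain ⟨P, hP, hPle, A', B', hcard', hW', hX'⟩ := exists_prime_sdpp_of_addEquiv hD hSD hm0 e
  have hPpos : (0 : ℝ) < P := by exact_mod_cast hP.pos
  refine ⟨n, by omega, P, hP, A', B', hW', hX', ?_, fun i => ?_⟩
  · -- `P ≤ 2 · 3^k · |H| ≤ n^{2+δ}`
    have hPR : (P : ℝ) ≤ 2 * ((3 : ℝ) ^ k * Fintype.card H) := by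
      rw [← hprod]; exact_mod_cast hPle
    have hlogP : Real.log P ≤ Real.log 2 + k * c3 + logH := by
      have h1 := Real.log_le_log hPpos hPR
      rw [Real.log_mul (by norm_num) (mul_pos (pow_pos (by norm_num) k) hHpos).ne',
        Real.log_mul (pow_pos (by norm_num) k).ne' hHpos.ne', Real.log_pow] at h1
      linarith
    rw [Real.rpow_def_of_pos hnpos, ← Real.exp_log hPpos, Real.exp_le_exp]
    calc Real.log P ≤ (2 + δ) * ℓn := hlogP.trans hexp
      _ = Real.log n * (2 + δ) := by rw [hℓn]; ring
  · -- sizes: `n^{2-δ} ≤ n^{2-δ'} ≤ |Aᵢ||Bᵢ| = |A'ᵢ||B'ᵢ|`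
    obtain ⟨hA', hB'⟩ := hcard' i
    rw [hA', hB']
    refine le_trans ?_ (hAB i)
    exact Real.rpow_le_rpow_of_exponent_le hn1.le (by linarith)

/-- **`CyclicReduction` holds** (item `stmt-MatrixMultiplication-14313`): CKSU Conj. 4.7 over all
finite abelian groups `↔` its prime-cyclic form `PrimeTwoFamilies`.  (←) take `H := ℤ/pℤ`;
(→) `primeTwoFamilies_of_abelian_aux` with `min δ 1`. -/
theorem cyclicReduction_proof :
    Summit.MatrixMultiplication.MatrixMultiplication.Theses.FourierTwoFamiliesModP.CyclicReduction := by
  unfold Summit.MatrixMultiplication.MatrixMultiplication.Theses.FourierTwoFamiliesModP.CyclicReduction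
    Summit.MatrixMultiplication.MatrixMultiplication.Theses.FourierTwoFamiliesModP.PrimeTwoFamilies
  constructor
  · intro hTF δ hδ n₀
    obtain ⟨n, hn, p, hp, A, B, hW, hX, hpn, hAB⟩ :=
      primeTwoFamilies_of_abelian_aux hTF (min δ 1) (lt_min hδ one_pos) (min_le_right _ _) (max n₀ 1)
    have hn1 : (1 : ℝ) ≤ n := by exact_mod_cast (le_max_right n₀ 1).trans hn
    have hmin : min δ 1 ≤ δ := min_le_left δ 1
    refine ⟨n, (le_max_left _ _).trans hn, p, hp, A, B, hW, hX, hpn.trans ?_,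
      fun i => le_trans ?_ (hAB i)⟩
    · exact Real.rpow_le_rpow_of_exponent_le hn1 (by linarith)
    · exact Real.rpow_le_rpow_of_exponent_le hn1 (by linarith)
  · intro hP δ hδ n₀
    obtain ⟨n, hn, p, hp, A, B, hW, hX, hpn, hAB⟩ := hP δ hδ n₀
    haveI : Fact p.Prime := ⟨hp⟩
    exact ⟨n, hn, ZMod p, inferInstance, inferInstance, A, B, hW, hX, by rwa [ZMod.card], hAB⟩

end Summit.MatrixMultiplication.MatrixMultiplication.Theorems
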